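import Summits.HodgeConjecture.HodgeConjecture.Theses.CurveNetMordellWeil
import Literature.AlgebraicGeometry.HodgeTheory.SupportedHodgeClassDescent
import Literature.AlgebraicGeometry.HodgeTheory.CubicFourfoldHodgeConjecture
import Literature.AlgebraicGeometry.HodgeTheory.LefschetzOneOne

/-!
# Route CurveNetMordellWeil · `CubicFourfoldNormalForm` (stmt-HodgeConjecture-2791) — the
Mordell–Weil normal form on cubic fourfolds, reduced to the tree's named facts

The support / calibration item `CubicFourfoldNormalForm` of the route
`Summits/HodgeConjecture/HodgeConjecture/Theses/CurveNetMordellWeil`: for every orientation family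
`μ` with Poincaré duality and every smooth cubic fourfold `X ⊂ ℙ⁵_ℂ`, the `ℂ`-span of the rational
`(2,2)`-classes in `H⁴(X(ℂ); ℂ)` lies in `⨆_{W, f} f_*(N¹H²(W(ℂ); ℂ))`, `W` ranging over smooth
projective THREEFOLDS and `f : W ⟶ X` over morphisms (Gysin images of divisor classes).

Mathematically this is the Hodge conjecture for cubic fourfolds (Zucker 1977, Thm. (3.2); Murre
1977) — the tree's NAMED FACT `hodgeTwoTwo_algebraic_cubicFourfold`, undischarged — composed with
the "easy half" of the route's Mordell–Weil normal form. This file PROVES: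

* `exists_le_coheight_eq_one` — order lemma: an element of finite codimension `c ≥ 1` in a
  preorder specialises from an element of codimension exactly `1`.
* `exists_family_codim_one_cover` — on a smooth projective `n`-fold, a Zariski-closed `Z` all of
  whose points have codimension `≥ 1` is CONTAINED in a finite union `⋃ⱼ gⱼ(Yⱼ)` of images of
  smooth projective varieties `Yⱼ` of dimension EXACTLY `n - 1` (enlarge each irreducible
  component `closure {xⱼ}` to the closure of a codimension-`1` generisation `tⱼ` of `xⱼ`, an
  irreducible divisor, and resolve it by the named fact `Resolution.Hironaka1964_projective`;
  the pure-codimension-one variant of the tree's `exists_family_iUnion_range_eq`).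
* `mem_iSup_map_algebraicClasses_one_of_mem_supportedClasses` — THE NORMAL FORM FOR SUPPORTED
  HODGE CLASSES ON FOURFOLDS: a rational `(2,2)`-class on a smooth projective fourfold which dies
  off a proper Zariski-closed subset (`c ∈ N¹H⁴`) is a `ℂ`-combination of Gysin images `g_*(β)` of
  DIVISOR classes `β ∈ N¹H²(Y)` on smooth projective threefolds `g : Y ⟶ X` — from Deligne's
  theorem (Hodge III, Cor. 8.2.8 = Voisin 2025 Thm. 4.4, named fact
  `Deligne1974_ker_restrictCompl_eq_iSup_range_complexGysin`), the lift of Hodge classes along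
  Gysin surjections (Voisin 2025, Cor. 2.12, named fact `Voisin2025_hodgeClass_lift_complexGysin`),
  Hironaka, and Lefschetz `(1,1)` on the threefolds (named fact `lefschetzOneOne_rational`): after
  the enlargement to pure codimension `1` the Gysin morphisms are `H²(Yⱼ) → H⁴(X)`, the lifted
  classes `βⱼ` are rational of type `(1,1)`, hence divisor classes.
* `cubicFourfoldNormalForm_of_facts` — the route decl VERBATIM from the five named facts (Zucker
  puts every rational `(2,2)`-class in `N²H⁴ ⊆ N¹H⁴`). CONDITIONAL: trust base = those five names.
* `cubicFourfoldNormalForm_of_algebraicInNormalForm` — the route decl from Zucker's fact and the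
  route's own support item `AlgebraicInNormalForm` at `p = 2` (the planner's intended composition).

Not here: any discharge of the named facts (Zucker's theorem needs normal functions on the pencil
of cubic threefolds / Clemens–Griffiths, or Bloch–Srinivas; XL and absent from the tree).
-/

noncomputable section

open CategoryTheory AlgebraicGeometry
open Literature.AlgebraicGeometry Literature.AlgebraicGeometry.Motives
open Literature.AlgebraicGeometry.HodgeTheory
open Literature.AlgebraicTopology.SingularHomology

namespace Summit.HodgeConjecture.HodgeConjecture.Theorems

/-! ### An order lemma: codimension-one generisations -/

/-- In a preorder, an element `z` of finite codimension `coheight z = c ≥ 1` lies below an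
element `t` of codimension exactly `1` (descend along `Order.coheight_eq_coe_iff`: an element of
codimension `c ≥ 2` has a strict generisation of codimension `c - 1`). [folklore] -/
theorem exists_le_coheight_eq_one {α : Type*} [Preorder α] :
    ∀ (c : ℕ) (z : α), Order.coheight z = c → 1 ≤ c → ∃ t, z ≤ t ∧ Order.coheight t = 1
  | 0, _, _, h => absurd h (by norm_num)
  | 1, z, hz, _ => ⟨z, le_rfl, by simpa using hz⟩
  | (c + 2), z, hz, _ => by
      obtain ⟨-, h2, -⟩ := Order.coheight_eq_coe_iff.1 hz
      rcases h2 with h | ⟨y, hyz, hy⟩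
      · exact absurd h (by omega)
      · have hy' : Order.coheight y = ((c + 1 : ℕ) : ℕ∞) := by
          rw [hy]
          norm_cast
        obtain ⟨t, hyt, ht⟩ := exists_le_coheight_eq_one (c + 1) y hy' (by omega)
        exact ⟨t, le_trans (le_of_lt hyz) hyt, ht⟩

/-! ### A proper closed subset is covered by resolved irreducible divisors -/

variable {n : ℕ} {X : Motives.SchemeOver ℂ}

/-- **A Zariski-closed subset of codimension `≥ 1` is contained in a finite union of images of
smooth projective varieties of dimension exactly `n - 1`.** For `X` smooth projective of dimension
`n = d + 1` and `Z ⊆ X` closed all of whose points have codimension `≥ 1`: the irreducible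
components `closure {xⱼ}` of `Z` are finitely many (`X` Noetherian); each generic point `xⱼ` has
finite codimension `≥ 1` (`dim + codim = n`), hence a generisation `tⱼ` of codimension exactly `1`
(`exists_le_coheight_eq_one`), whose closure is an irreducible divisor containing `closure {xⱼ}`,
of dimension `height tⱼ = n - 1 = d`; its reduced closed subscheme (`Motives.ClosedSubvariety.ofPoint`)
is resolved by the named fact `Resolution.Hironaka1964_projective` (Kollár 2007, Thm. 3.27: a
birational morphism from a smooth projective variety of the same dimension `d`), and a proper
birational morphism is surjective, so the images cover `⋃ⱼ closure {tⱼ} ⊇ Z`.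
[cite: Kollar2007, Thm. 3.27] [cite: Hartshorne1977, II Ex. 3.20 and I Cor. 1.6] -/
theorem exists_family_codim_one_cover (hH : Resolution.Hironaka1964_projective.{0})
    (hX : Motives.IsSmoothProjective n X) {d : ℕ} (hdn : d + 1 = n) {Z : Set X.left}
    (hZ : IsClosed Z) (hZ1 : ∀ z ∈ Z, (1 : ℕ∞) ≤ Order.coheight z) :
    ∃ (ι : Type) (_ : Finite ι) (Y : ι → Motives.SchemeOver ℂ)
      (_ : ∀ j, Motives.IsSmoothProjective d (Y j)) (g : ∀ j, Y j ⟶ X),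
      Z ⊆ ⋃ j, Set.range (g j).left.base := by
  haveI := noetherianSpace_of_isSmoothProjective hX
  obtain ⟨S, hSfin, hSclosed, hSirr, rfl⟩ :=
    TopologicalSpace.NoetherianSpace.exists_finite_set_isClosed_irreducible hZ
  haveI : Finite S := hSfin.to_subtype
  -- generic points of the components
  let x : S → X.left := fun j ↦ (hSirr j.1 j.2).genericPoint
  have hx : ∀ j : S, closure {x j} = (j : Set X.left) := fun j ↦
    (hSirr j.1 j.2).closure_genericPoint (hSclosed j.1 j.2)
  -- each has finite codimension `≥ 1`: choose a generisation of codimension exactly `1`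
  have ht : ∀ j : S, ∃ t : X.left, x j ≤ t ∧ Order.coheight t = 1 := fun j ↦ by
    have hxZ : x j ∈ ⋃₀ S :=
      Set.subset_sUnion_of_mem j.2
        ((hSirr j.1 j.2).isGenericPoint_genericPoint (hSclosed j.1 j.2)).mem
    obtain ⟨a, c, -, hc, -⟩ := exists_height_eq_coheight_eq hX (x j)
    have h1 := hZ1 (x j) hxZ
    rw [hc] at h1
    exact exists_le_coheight_eq_one c (x j) hc (by exact_mod_cast h1)
  choose t hxt htc using ht
  -- the irreducible divisors `closure {t j}` with their reduced structures
  let X₀ : ∀ j : S, Motives.ClosedSubvariety X.left := fun j ↦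
    Motives.ClosedSubvariety.ofPoint X.left (t j)
  -- resolve each (Hironaka, projective form)
  have hres : ∀ j : S, ∃ (d' : ℕ) (Y : Motives.SchemeOver ℂ) (π : Y ⟶ (X₀ j).toSchemeOver),
      Motives.IsSmoothProjective d' Y ∧ Resolution.IsBirational π.left ∧
        Order.height (genericPoint (X₀ j).carrier) = (d' : ℕ∞) := fun j ↦ by
    haveI : IsIntegral (X₀ j).toSchemeOver.left := inferInstanceAs (IsIntegral (X₀ j).carrier)
    exact hH ℂ (X₀ j).toSchemeOver (isProjectiveOver_toSchemeOver (X₀ j) hX.isProjectiveOver)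
  choose m Y π hY hπ hdim using hres
  -- every resolution has dimension `height (t j) = n - 1 = d`
  have hm : ∀ j, m j = d := fun j ↦ by
    have h1 : Order.height (t j) = (m j : ℕ∞) := by
      have e1 : (X₀ j).ι.base (genericPoint (X₀ j).carrier) = t j :=
        Motives.ClosedSubvariety.genericPoint_ofPoint (t j)
      have e2 : Order.height ((X₀ j).ι.base (genericPoint (X₀ j).carrier)) =
          Order.height (genericPoint (X₀ j).carrier) :=
        Motives.Scheme.height_base_eq_of_isClosedImmersion _ _
      rw [← e1, e2]
      exact hdim j
    obtain ⟨a, c, ha, hc, hac⟩ := exists_height_eq_coheight_eq hX (t j)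
    rw [ha] at h1
    rw [htc j] at hc
    have h1' : a = m j := by exact_mod_cast h1
    have hc' : (1 : ℕ) = c := by exact_mod_cast hc
    omega
  refine ⟨S, inferInstance, Y, fun j ↦ hm j ▸ hY j, fun j ↦ π j ≫ (X₀ j).ιOver, ?_⟩
  -- `⋃₀ S = ⋃ closure {x j} ⊆ ⋃ closure {t j} = ⋃ range (π j ≫ ι j)`
  rw [Set.sUnion_eq_iUnion]
  refine Set.iUnion_mono fun j ↦ ?_
  haveI : IsProper (π j).left := by
    haveI : IsProper (Y j).hom := Motives.IsSmoothProjective.isProper_holds (hY j)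
    haveI : IsProper (X₀ j).toSchemeOver.hom := Motives.IsProjectiveOver.isProper
      (isProjectiveOver_toSchemeOver (X₀ j) hX.isProjectiveOver)
    have h : IsProper ((π j).left ≫ (X₀ j).toSchemeOver.hom) := by
      rw [Over.w (π j)]
      infer_instance
    exact MorphismProperty.of_postcomp (W := @IsProper) (W' := @IsSeparated) (π j).left
      (X₀ j).toSchemeOver.hom inferInstance h
  have hsurj := surjective_base_of_isBirational (π j).left (hπ j)
  intro z hz
  have hz' : z ∈ closure {t j} := by
    have hz1 : z ∈ closure {x j} := by rw [hx j]; exact hz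
    have hxt' : x j ∈ closure {t j} :=
      specializes_iff_mem_closure.1 (Scheme.le_iff_specializes.1 (hxt j))
    exact closure_minimal (Set.singleton_subset_iff.2 hxt') isClosed_closure hz1
  rw [← Motives.ClosedSubvariety.range_ofPoint_ι (t j)] at hz'
  obtain ⟨v, rfl⟩ := hz'
  obtain ⟨y, rfl⟩ := hsurj v
  exact ⟨y, rfl⟩

/-! ### The normal form for supported Hodge classes on fourfolds -/

/-- **Mordell–Weil normal form for supported `(2,2)`-classes on a fourfold.** Let `X` be smooth
projective of dimension `4` and `c ∈ H⁴(X(ℂ); ℂ)` a rational class of Hodge type `(2,2)` supported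
in codimension `≥ 1` (`c ∈ N¹H⁴`, e.g. `c` algebraic). Then `c` lies in
`⨆_{W, f} f_*(N¹H²(W(ℂ); ℂ))` over smooth projective threefolds `W` and morphisms `f : W ⟶ X`:
`c` dies off one closed `Z` of codimension `≥ 1` (`exists_isClosed_of_mem_supportedClasses`),
hence off the finite union `⋃ⱼ gⱼ(Yⱼ) ⊇ Z` of images of smooth projective THREEFOLDS
(`exists_family_codim_one_cover`); by Deligne's theorem (Hodge III Cor. 8.2.8 = Voisin 2025,
Thm. 4.4; `hD`) chained with the lift of Hodge classes along Gysin surjections (Voisin 2025,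
Cor. 2.12; `hV`), `c = Σⱼ (gⱼ)_* βⱼ` with `βⱼ` in the span of the rational `(1,1)`-classes of
`H²(Yⱼ(ℂ); ℂ)` (the only degree with `2d + 8 = 4 + 6`), and those are divisor classes by Lefschetz
`(1,1)` (`hL`). Granted: the four named facts and Poincaré duality for `μ`.
[cite: Voisin2025, Cor. 2.12 (p. 24), Thm. 4.4 and Cor. 4.5 (p. 38)]
[cite: DeligneHodgeIII1974, Cor. 8.2.8] [cite: VoisinHodgeI2002, Thm. 11.30 and §11.3.3] -/
theorem mem_iSup_map_algebraicClasses_one_of_mem_supportedClasses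
    (hD : Deligne1974_ker_restrictCompl_eq_iSup_range_complexGysin)
    (hV : Voisin2025_hodgeClass_lift_complexGysin)
    (hH : Resolution.Hironaka1964_projective.{0}) (hL : lefschetzOneOne_rational)
    (μ : OrientationFamily) (hμ : μ.HasPoincareDuality)
    (hX : Motives.IsSmoothProjective (2 * 2) X) (c : complexBetti X (2 * 2))
    (hc : IsRationalClass c) (hc' : IsOfHodgeType (2 * 2) X (2 * 2) 2 2 c)
    (hs : c ∈ supportedClasses X (2 * 2) 1) :
    c ∈ ⨆ (W : Motives.SchemeOver ℂ) (hW : Motives.IsSmoothProjective (2 + 1) W) (f : W ⟶ X),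
      (algebraicClasses W 1).map
        (complexGysin μ hW hX f (show 2 * 1 + 2 * (2 * 2) = 2 * 2 + 2 * (2 + 1) by omega)) := by
  -- one closed `Z` of codimension `≥ 1`
  obtain ⟨Z, hZ, hZ1, hcZ⟩ := exists_isClosed_of_mem_supportedClasses hs
  -- `Z ⊆ ⋃_j g_j(Y j)`, `dim Y j = 3`
  obtain ⟨ι, _, Y, hY, g, hZsub⟩ :=
    exists_family_codim_one_cover hH hX (d := 2 + 1) (by norm_num) hZ hZ1
  have h0 : complexBetti.restrictCompl X (⋃ j, Set.range (g j).left.base) (2 * 2) c = 0 :=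
    complexBetti.restrictCompl_eq_zero_of_subset hZsub hcZ
  -- Deligne + Cor. 2.12: `c ∈ Σ_j (g j)_* (span of rational Hodge classes)`
  have hmem := Voisin2025_hodgeClass_lift_complexGysin.mem_iSup_map_of_restrictCompl_eq_zero
    hD hV μ hμ hX (m := fun _ ↦ 2 + 1) hY g rfl hc hc' h0
  refine SetLike.le_def.1 (iSup_le fun j ↦ iSup_le fun d ↦ iSup_le fun hd ↦ ?_) hmem
  -- the Gysin morphisms are `H²(Y j) → H⁴(X)`: `d = 1`
  obtain rfl : d = 1 := by omega
  refine le_iSup_of_le (Y j) (le_iSup_of_le (hY j) (le_iSup_of_le (g j) ?_))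
  refine Submodule.map_mono (Submodule.span_le.2 ?_)
  rintro b ⟨hb, hb'⟩
  -- Lefschetz `(1,1)` on the threefold `Y j`
  exact hL (hY j) b hb hb'

/-! ### The item, from the named facts -/

/-- **`CubicFourfoldNormalForm` from the tree's named facts** (route `CurveNetMordellWeil`, item
stmt-HodgeConjecture-2791, stated VERBATIM as the route decl): for every orientation family `μ`
with Poincaré duality and every smooth cubic fourfold `X ⊂ ℙ⁵_ℂ`, the span of the rational
`(2,2)`-classes of `H⁴(X(ℂ); ℂ)` lies in `⨆_{W, f} f_*(N¹H²(W))` over smooth projective threefolds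
`W ⟶ X`. Proof: by the Hodge conjecture for cubic fourfolds (Zucker 1977, Thm. (3.2); Murre 1977 —
named fact `hodgeTwoTwo_algebraic_cubicFourfold`, `hZu`) every such class is algebraic,
`c ∈ N²H⁴ ⊆ N¹H⁴`, and `mem_iSup_map_algebraicClasses_one_of_mem_supportedClasses` (Deligne `hD`,
Voisin Cor. 2.12 `hV`, Hironaka `hH`, Lefschetz `(1,1)` `hL`) puts it in normal form.
CONDITIONAL on the five named facts (its trust base); nothing else is assumed.
[cite: Zucker1977, (3.2) Theorem, p. 206] [cite: Murre1977, Theorem and Corollary, p. 230]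
[cite: Voisin2025, Cor. 2.12, Thm. 4.4 and Cor. 4.5] [cite: DeligneHodgeIII1974, Cor. 8.2.8] -/
theorem cubicFourfoldNormalForm_of_facts (hZu : hodgeTwoTwo_algebraic_cubicFourfold)
    (hD : Deligne1974_ker_restrictCompl_eq_iSup_range_complexGysin)
    (hV : Voisin2025_hodgeClass_lift_complexGysin)
    (hH : Resolution.Hironaka1964_projective.{0}) (hL : lefschetzOneOne_rational) :
    Theses.CurveNetMordellWeil.CubicFourfoldNormalForm := by
  unfold Theses.CurveNetMordellWeil.CubicFourfoldNormalForm
  intro μ hμ X hX hXc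
  refine Submodule.span_le.2 ?_
  rintro c ⟨hc, hc'⟩
  -- Zucker: `c` is algebraic, in particular supported in codimension `≥ 1`
  have halg : c ∈ algebraicClasses X 2 := hZu hXc c hc hc'
  have hs : c ∈ supportedClasses X (2 * 2) 1 :=
    supportedClasses_mono X (2 * 2) (show 1 ≤ 2 by norm_num) halg
  exact mem_iSup_map_algebraicClasses_one_of_mem_supportedClasses hD hV hH hL μ hμ hX c hc hc' hs

/-! ### The item, from Zucker's theorem and the route's easy half of the normal form -/

/-- **`CubicFourfoldNormalForm` = Zucker 1977 + `AlgebraicInNormalForm` at `p = 2`** (the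
planner's intended composition, recorded as a reduction between route decls): the Hodge conjecture
for cubic fourfolds (named fact `hodgeTwoTwo_algebraic_cubicFourfold`) bounds the span of the
rational `(2,2)`-classes by `algebraicClasses X 2`, and the route's support item
`AlgebraicInNormalForm` (every algebraic class of codimension `p` on a smooth projective `2p`-fold
is a combination of Gysin images of divisor classes from smooth projective `(p+1)`-folds), at
`p = 2`, bounds that by the normal form. [cite: Zucker1977, (3.2) Theorem, p. 206]
[cite: Murre1977, Theorem and Corollary, p. 230] -/
theorem cubicFourfoldNormalForm_of_algebraicInNormalForm (hZu : hodgeTwoTwo_algebraic_cubicFourfold)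
    (hN : Theses.CurveNetMordellWeil.AlgebraicInNormalForm) :
    Theses.CurveNetMordellWeil.CubicFourfoldNormalForm := by
  unfold Theses.CurveNetMordellWeil.CubicFourfoldNormalForm
  intro μ hμ X hX hXc
  refine le_trans (Submodule.span_le.2 ?_) (hN μ hμ hX (show 1 ≤ 2 by norm_num))
  rintro c ⟨hc, hc'⟩
  exact hZu hXc c hc hc'

end Summit.HodgeConjecture.HodgeConjecture.Theorems

end
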